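import Literature.MathematicalPhysics.QuantumLattice.HubbardHoleCountingBound
import Summits.HubbardSuperconductivity.HubbardLadder.Bounds.AttractiveStiffnessCeiling
import HarnessLib

/-!
# Hubbard ladder — Bounds: the pair-breaking counting floor of the attractive Hubbard class
# (bounds.tex Thm 9(i), typed AND proved; part 1 of 2)

HONEST FRAMING (cell pub-hubbard): ladder R1–R4 with certified numbers; no claim on H/H₀.
Bounds for a MODEL CLASS (Hubbard `-t T_G + U Σ n↑n↓` on a finite graph of maximal degree
`≤ Δ`; the torus `hubbardTorus 2 L 1 U`, `t = 1`, `t' = 0`, `U < 0`); no materials claim.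
Companion text: `pub-hubbard/paper/bounds.tex` §9 (Thm 9 = SHARPENING #9: the first kinetic /
stiffness ceilings of the attractive class proportional to the DENSITY times `t²/|U|`); tables
`pub-hubbard-bounds/BOUNDS.md` row T7. Part 2 = `AttractiveStiffnessCeilingDensity.lean`.

## What is proved (no `sorry`, no new axioms)

The attractive ceilings filed so far (`⟨-T⟩ ≤ 40 L²/|U|`, `ρ_s ≤ 10/|U|` of
`AttractiveStiffnessCeiling.lean`; the tight-chord `32 L²/|U|`, `8/|U|`) are VOLUME-proportional:
their lower bracket is the Langer–Mattis floor `U m - 8 L²/|U|`, a sum over all momenta. The floor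
of this file counts PARTICLES instead.
* `pairBreaking_le_re_expect_hamiltonian`: on a finite graph of maximal degree `≤ Δ`, for
  every unit `N`-particle vector `φ` and every `ω ≥ 1`:
  `Re⟨φ,Hφ⟩ ≥ -|t|Δ ω N + (U + |t|Δ(2ω - 2ω⁻¹)) Re⟨φ, Σ_x n_{x↑}n_{x↓} φ⟩`. Mechanism: the
  tree's occupation-basis Young/Schur bookkeeping (`norm_expect_hoppingForm_le_of_weights`,
  weight `c_{xy}(s) = ω^{1(y occupied)} ω^{-1(x doubly occupied)}` of `HubbardHopWeightCounting`)
  and a NEW configuration-wise count adapted to FEW SINGLY OCCUPIED sites (the mirror image of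
  the hole counting of Nagaoka1966 §II / `HubbardHoleCountingBound.lean`):
  `Σ_{x∼y,σ} 1(xσ∈s,yσ∉s) c_{xy}(s) ≤ ωΔ #single(s) + 2ω⁻¹Δ #dbl(s)`, `#single = |s| - 2 #dbl`
  (`sum_spin_weight_le_singles`, `sum_ite_single_eq`, `sum_adj_weight_le_singles`): a singly
  occupied site owns `≤ Δ` neighbour slots each carrying at most ONE move, of weight `≤ ω`, and a
  doubly occupied site `≤ 2Δ` pair-breaking moves of weight `ω⁻¹`.
* `pairBreaking_le_minEnergyOn_szSector`: `ω ≥ 1`, `-U ≤ |t|Δ(2ω - 2ω⁻¹)` ⇒ every nonempty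
  joint sector has `E ≥ -|t|Δ ω N`; `ω = |U|/(2|t|Δ) + 2|t|Δ/|U|` gives
  `E ≥ U N/2 - 2Δ²t² N/|U|`: binding `U` per pair plus a pair-breaking fluctuation budget
  `4Δ²t²/|U|` per pair (second-order perturbation theory: `≈ 16 t²/|U|` per dilute pair on the
  square lattice, so the constant `64` below is loose by `≈ 4`; the optimal `ω` gives
  `E ≥ -(N/4)(|U| + √(U² + 16Δ²t²))`, paper only).
* `AttractivePairBreakingFloor` (`@[conjecture] def`, PROVED by `…_holds`): torus, `U < 0`, every
  `L`, every nonempty sector `(N, S^z = M)`: `E ≥ -(|U|/2 + 32/|U|) N`; in the sector `(2m, 0)`: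
  `E_L(U; 2m, 0) ≥ U m - 64 m/|U|` (`sectorEnergy_two_mul_ge_pairBreaking`; the Langer–Mattis
  floor `U m - 8 L²/|U|` is the better one iff `m > L²/8`, i.e. density `n > 1/4`).
References (`lean/references.bib`): Nagaoka1966 §II; LiebPRL1989 (`E(2m) = E(2m, 0)`);
HazraVermaRanderia2019 App. G (BEC regime, heuristic `T_c ∝ n t²/|U|`); KomaTasaki1994 §1.
-/

noncomputable section

namespace Summit.HubbardSuperconductivity.HubbardLadder.Bounds

open Matrix Finset Real Filter Topology
open Literature.MathematicalPhysics.QuantumLattice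
open Literature.MathematicalPhysics.QuantumFieldTheory
open Literature.Probability.LatticeModels
open Literature.MathematicalPhysics.QuantumLattice.ThermodynamicLimit
open scoped ComplexOrder ComplexConjugate Topology

/-! ### Pair-breaking counting on a general finite graph -/

section Graph

variable {Λ : Type*} [LinearOrder Λ] [Fintype Λ]

omit [Fintype Λ] in
/-- **Configuration-wise weight bound, few-singles form** (`ω ≥ 1`):
`Σ_σ 1(xσ∈s, yσ∉s) c_{xy}(s) ≤ ω 1(x single) 1(y not double) + 2ω⁻¹ 1(x double) 1(y empty)`
`+ 1(x double) 1(y single)` (cases: `x` single, `y` empty: `1 ≤ ω`; `x` single, `y` the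
other spin: `ω`; `x` double, `y` empty: `2ω⁻¹`; `x` double, `y` single: `1`; else `0`). -/
theorem sum_spin_weight_le_singles {ω : ℝ} (hω : 1 ≤ ω) (x y : Λ) (s : Finset (Orb Λ)) :
    ∑ σ : Fin 2, (if orb x σ ∈ s ∧ orb y σ ∉ s then
        ((if (orb y 0 ∈ s ∨ orb y 1 ∈ s) then ω else 1) *
          (if (orb x 0 ∈ s ∧ orb x 1 ∈ s) then ω⁻¹ else 1)) else 0) ≤
      ω * (if ((orb x 0 ∈ s ∨ orb x 1 ∈ s) ∧ ¬(orb x 0 ∈ s ∧ orb x 1 ∈ s)) then (1 : ℝ)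
            else 0) * (if ¬(orb y 0 ∈ s ∧ orb y 1 ∈ s) then (1 : ℝ) else 0) +
        2 * ω⁻¹ * (if (orb x 0 ∈ s ∧ orb x 1 ∈ s) then (1 : ℝ) else 0) *
          (if (orb y 0 ∉ s ∧ orb y 1 ∉ s) then (1 : ℝ) else 0) +
        (if (orb x 0 ∈ s ∧ orb x 1 ∈ s) then (1 : ℝ) else 0) *
          (if ((orb y 0 ∈ s ∨ orb y 1 ∈ s) ∧ ¬(orb y 0 ∈ s ∧ orb y 1 ∈ s)) then (1 : ℝ)
            else 0) := by
  have hω0 : 0 < ω := by linarith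
  have hω' : 0 < ω⁻¹ := inv_pos.2 hω0
  have hω1 : ω⁻¹ ≤ 1 := inv_le_one_of_one_le₀ hω
  have hωω : ω * ω⁻¹ = 1 := mul_inv_cancel₀ hω0.ne'
  rw [Fin.sum_univ_two]
  by_cases hx0 : orb x 0 ∈ s <;> by_cases hx1 : orb x 1 ∈ s <;> by_cases hy0 : orb y 0 ∈ s <;>
    by_cases hy1 : orb y 1 ∈ s <;> simp [hx0, hx1, hy0, hy1, hωω] <;> linarith

/-- **Singles count**: `#single(s) = |s| - 2 #doublyOccupied(s)`. -/
theorem sum_ite_single_eq (s : Finset (Orb Λ)) :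
    ∑ x : Λ, (if ((orb x 0 ∈ s ∨ orb x 1 ∈ s) ∧ ¬(orb x 0 ∈ s ∧ orb x 1 ∈ s)) then (1 : ℝ) else 0) =
      (s.card : ℝ) - 2 * (doublyOccupied s).card := by
  have hpt : ∀ x : Λ,
      (if ((orb x 0 ∈ s ∨ orb x 1 ∈ s) ∧ ¬(orb x 0 ∈ s ∧ orb x 1 ∈ s)) then (1 : ℝ) else 0) =
        1 - (if (orb x 0 ∉ s ∧ orb x 1 ∉ s) then (1 : ℝ) else 0) -
          (if (orb x 0 ∈ s ∧ orb x 1 ∈ s) then (1 : ℝ) else 0) := by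
    intro x
    by_cases hx0 : orb x 0 ∈ s <;> by_cases hx1 : orb x 1 ∈ s <;> simp [hx0, hx1]
  rw [Finset.sum_congr rfl fun x _ => hpt x, Finset.sum_sub_distrib, Finset.sum_sub_distrib,
    sum_ite_empty_eq s, sum_ite_doublyOccupied s, Finset.sum_const, Finset.card_univ, nsmul_eq_mul,
    mul_one]
  ring

variable (G : SimpleGraph Λ) [DecidableRel G.Adj]

/-- **Configuration-wise count, few-singles form** (maximal degree `≤ Δ`, `ω ≥ 1`):
`Σ_{x∼y} Σ_σ 1(xσ∈s, yσ∉s) c_{xy}(s) ≤ ωΔ(|s| - 2 #dbl(s)) + 2ω⁻¹Δ #dbl(s)`: a singly occupied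
site owns `≤ Δ` neighbour slots, each carrying at most ONE move of weight `≤ ω` (neutral to an
empty site; pair-restoring with an opposite single; a doubly occupied neighbour's electron joining
it); a doubly occupied site owns `≤ 2Δ` pair-breaking moves of weight `ω⁻¹`. -/
theorem sum_adj_weight_le_singles {Δ : ℕ} (hΔ : ∀ v : Λ, (Finset.univ.filter (G.Adj v)).card ≤ Δ)
    {ω : ℝ} (hω : 1 ≤ ω) (s : Finset (Orb Λ)) :
    ∑ x, ∑ y, (if G.Adj x y then
        ∑ σ : Fin 2, (if orb x σ ∈ s ∧ orb y σ ∉ s then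
          ((if (orb y 0 ∈ s ∨ orb y 1 ∈ s) then ω else 1) *
            (if (orb x 0 ∈ s ∧ orb x 1 ∈ s) then ω⁻¹ else 1)) else 0) else 0) ≤
      ω * Δ * ((s.card : ℝ) - 2 * (doublyOccupied s).card) +
        2 * ω⁻¹ * Δ * (doublyOccupied s).card := by
  have hω0 : 0 < ω := by linarith
  set Sg : Λ → ℝ := fun x =>
    if ((orb x 0 ∈ s ∨ orb x 1 ∈ s) ∧ ¬(orb x 0 ∈ s ∧ orb x 1 ∈ s)) then (1 : ℝ) else 0 with hSg
  set Db : Λ → ℝ := fun x => if (orb x 0 ∈ s ∧ orb x 1 ∈ s) then (1 : ℝ) else 0 with hDb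
  set Em : Λ → ℝ := fun y => if (orb y 0 ∉ s ∧ orb y 1 ∉ s) then (1 : ℝ) else 0 with hEm
  set ND : Λ → ℝ := fun y => if ¬(orb y 0 ∈ s ∧ orb y 1 ∈ s) then (1 : ℝ) else 0 with hND
  set A : Λ → Λ → ℝ := fun x y => if G.Adj x y then (1 : ℝ) else 0 with hA
  have hS0 : ∀ x, 0 ≤ Sg x := fun x => by simp only [hSg]; split_ifs <;> norm_num
  have hD0 : ∀ x, 0 ≤ Db x := fun x => by simp only [hDb]; split_ifs <;> norm_num
  have hE1 : ∀ y, Em y ≤ 1 := fun y => by simp only [hEm]; split_ifs <;> norm_num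
  have hNDD : ∀ y, ND y + Db y = 1 := fun y => by
    by_cases h : orb y 0 ∈ s ∧ orb y 1 ∈ s
    · simp only [hND, hDb, if_neg (not_not.2 h), if_pos h]; norm_num
    · simp only [hND, hDb, if_pos h, if_neg h]; norm_num
  have hA0 : ∀ x y, 0 ≤ A x y := fun x y => by simp only [hA]; split_ifs <;> norm_num
  have hAsymm : ∀ x y, A x y = A y x := fun x y => by
    by_cases h : G.Adj x y
    · simp only [hA, if_pos h, if_pos h.symm]
    · simp only [hA, if_neg h, if_neg fun h' : G.Adj y x => h h'.symm]
  have hAdeg : ∀ x, ∑ y, A x y ≤ Δ := fun x => sum_ite_adj_le G hΔ x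
  -- bond by bond (`sum_spin_weight_le_singles`), then split into three double sums
  have step1 : ∑ x, ∑ y, (if G.Adj x y then
      ∑ σ : Fin 2, (if orb x σ ∈ s ∧ orb y σ ∉ s then
        ((if (orb y 0 ∈ s ∨ orb y 1 ∈ s) then ω else 1) *
          (if (orb x 0 ∈ s ∧ orb x 1 ∈ s) then ω⁻¹ else 1)) else 0) else 0) ≤
      ω * (∑ x, ∑ y, A x y * Sg x * ND y) + 2 * ω⁻¹ * (∑ x, ∑ y, A x y * Db x * Em y) +
        ∑ x, ∑ y, A x y * Db x * Sg y := by
    have hsplit : ω * (∑ x, ∑ y, A x y * Sg x * ND y) + 2 * ω⁻¹ * (∑ x, ∑ y, A x y * Db x * Em y) +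
        ∑ x, ∑ y, A x y * Db x * Sg y = ∑ x, ∑ y, (ω * (A x y * Sg x * ND y) +
          2 * ω⁻¹ * (A x y * Db x * Em y) + A x y * Db x * Sg y) := by
      simp only [Finset.sum_add_distrib, Finset.mul_sum]
    rw [hsplit]
    refine Finset.sum_le_sum fun x _ => Finset.sum_le_sum fun y _ => ?_
    by_cases hxy : G.Adj x y
    · have h := sum_spin_weight_le_singles hω x y s
      simp only [hA, hSg, hDb, hEm, hND, if_pos hxy, one_mul]
      linarith
    · simp only [hA, if_neg hxy, zero_mul, mul_zero, add_zero, le_refl]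
  -- pair breaking: at most `Δ` empty neighbours per doubly occupied site
  have hB : ∑ x, ∑ y, A x y * Db x * Em y ≤ Δ * (doublyOccupied s).card := by
    rw [← sum_ite_doublyOccupied s, Finset.mul_sum]
    refine Finset.sum_le_sum fun x _ => ?_
    calc ∑ y, A x y * Db x * Em y ≤ ∑ y, A x y * Db x := Finset.sum_le_sum fun y _ => by
            simpa using mul_le_mul_of_nonneg_left (hE1 y) (mul_nonneg (hA0 x y) (hD0 x))
      _ = (∑ y, A x y) * Db x := by rw [Finset.sum_mul]
      _ ≤ Δ * Db x := mul_le_mul_of_nonneg_right (hAdeg x) (hD0 x)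
  -- third sum re-indexed by its singly occupied endpoint; singles own `≤ Δ` slots, weight `≤ ω`
  have hC : ∑ x, ∑ y, A x y * Db x * Sg y = ∑ y, ∑ x, A y x * Db x * Sg y := by
    rw [Finset.sum_comm]
    exact Finset.sum_congr rfl fun y _ => Finset.sum_congr rfl fun x _ => by rw [hAsymm x y]
  have hAC : ω * (∑ x, ∑ y, A x y * Sg x * ND y) + ∑ x, ∑ y, A x y * Db x * Sg y ≤
      ω * Δ * ∑ x, Sg x := by
    rw [hC, Finset.mul_sum, Finset.mul_sum, ← Finset.sum_add_distrib]
    refine Finset.sum_le_sum fun u _ => ?_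
    have hslot : ω * ∑ v, A u v * Sg u * ND v + ∑ v, A u v * Db v * Sg u ≤
        ω * ∑ v, A u v * Sg u * (ND v + Db v) := by
      rw [Finset.mul_sum, Finset.mul_sum, ← Finset.sum_add_distrib]
      refine Finset.sum_le_sum fun v _ => ?_
      have h0 : 0 ≤ A u v * Sg u * Db v := mul_nonneg (mul_nonneg (hA0 u v) (hS0 u)) (hD0 v)
      nlinarith
    have hone : ∑ v, A u v * Sg u * (ND v + Db v) = (∑ v, A u v) * Sg u := by
      rw [Finset.sum_mul]
      exact Finset.sum_congr rfl fun v _ => by rw [hNDD v, mul_one]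
    rw [hone] at hslot
    have h2 : ω * ((∑ v, A u v) * Sg u) ≤ ω * (Δ * Sg u) :=
      mul_le_mul_of_nonneg_left (mul_le_mul_of_nonneg_right (hAdeg u) (hS0 u)) hω0.le
    linarith
  rw [show ∑ x, Sg x = (s.card : ℝ) - 2 * (doublyOccupied s).card from sum_ite_single_eq s] at hAC
  have h3 := mul_le_mul_of_nonneg_left hB (by positivity : (0 : ℝ) ≤ 2 * ω⁻¹)
  linarith

/-- **Pair-breaking counting bounds the Hubbard energy from below.** Maximal degree `≤ Δ`, unit
`N`-particle `φ`, `ω ≥ 1`: `Re⟨φ,Hφ⟩ ≥ -|t|Δ ω N + (U + |t|Δ(2ω - 2ω⁻¹)) Re⟨φ, Σ_x n↑n↓ φ⟩`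
(kinetic energy at most `|t|Δ ω` per singly and `2|t|Δ ω⁻¹` per doubly occupied site). -/
theorem pairBreaking_le_re_expect_hamiltonian {Δ : ℕ}
    (hΔ : ∀ v : Λ, (Finset.univ.filter (G.Adj v)).card ≤ Δ) (t U : ℝ) {ω : ℝ} (hω : 1 ≤ ω)
    {N : ℕ} {φ : Fock (Orb Λ)} (hN : IsNParticle N φ) (hφ : star φ ⬝ᵥ φ = 1) :
    -(|t| * Δ * ω * N) + (U + |t| * Δ * (2 * ω - 2 * ω⁻¹)) *
          (star φ ⬝ᵥ ((∑ x : Λ, numberOp x 0 * numberOp x 1) *ᵥ φ)).re ≤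
      (star φ ⬝ᵥ (hamiltonian G t U *ᵥ φ)).re := by
  have hω0 : 0 < ω := by linarith
  have hH : hamiltonian G t U =
      -(t : ℂ) • hoppingForm G (fun _ _ => 1) + (U : ℂ) • ∑ x : Λ, numberOp x 0 * numberOp x 1 := by
    rw [hamiltonian, ← hoppingForm_one]
  set zT : ℂ := star φ ⬝ᵥ (hoppingForm G (fun _ _ => 1) *ᵥ φ) with hzT
  set D : ℝ := (star φ ⬝ᵥ ((∑ x : Λ, numberOp x 0 * numberOp x 1) *ᵥ φ)).re with hDdef
  have hform : (star φ ⬝ᵥ (hamiltonian G t U *ᵥ φ)).re = -t * zT.re + U * D := by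
    rw [hH, add_mulVec, smul_mulVec, smul_mulVec, dotProduct_add, dotProduct_smul,
      dotProduct_smul, Complex.add_re, smul_eq_mul, smul_eq_mul, ← Complex.ofReal_neg,
      Complex.re_ofReal_mul, Complex.re_ofReal_mul]
  have hT : ‖zT‖ ≤ ∑ s, ‖φ s‖ ^ 2 * (ω * Δ * ((s.card : ℝ) - 2 * (doublyOccupied s).card) +
      2 * ω⁻¹ * Δ * (doublyOccupied s).card) := by
    refine norm_expect_hoppingForm_le_of_weights G φ
      (fun b s => if orb b.1 b.2.2 ∈ s ∧ orb b.2.1 b.2.2 ∉ s then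
        ((if (orb b.2.1 0 ∈ s ∨ orb b.2.1 1 ∈ s) then ω else 1) *
          (if (orb b.1 0 ∈ s ∧ orb b.1 1 ∈ s) then ω⁻¹ else 1)) else 0)
      _ (fun b hb => ?_) (fun s => sum_adj_weight_le_singles G hΔ hω s)
    obtain ⟨x, y, σ⟩ := b
    have h := norm_expect_bondOp_le_weighted hb σ hω0 φ
    simp only [ite_mul, zero_mul] at h ⊢
    exact h
  have hDsum : D = ∑ s, ((doublyOccupied s).card : ℝ) * ‖φ s‖ ^ 2 :=
    re_expect_interaction_eq_sum φ
  have hNsum := sum_norm_sq_mul_card_of_isNParticle hN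
  rw [sum_norm_sq_eq_one_of_unit hφ, mul_one] at hNsum
  have hexpand : ∑ s, ‖φ s‖ ^ 2 * (ω * Δ * ((s.card : ℝ) - 2 * (doublyOccupied s).card) +
      2 * ω⁻¹ * Δ * (doublyOccupied s).card) = ω * Δ * N - Δ * (2 * ω - 2 * ω⁻¹) * D := by
    have hterm : ∀ s : Finset (Orb Λ), ‖φ s‖ ^ 2 * (ω * Δ * ((s.card : ℝ) -
        2 * (doublyOccupied s).card) + 2 * ω⁻¹ * Δ * (doublyOccupied s).card) =
        ω * Δ * (‖φ s‖ ^ 2 * (s.card : ℝ)) -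
          Δ * (2 * ω - 2 * ω⁻¹) * (((doublyOccupied s).card : ℝ) * ‖φ s‖ ^ 2) := by
      intro s; ring
    rw [Finset.sum_congr rfl fun s _ => hterm s, Finset.sum_sub_distrib, ← Finset.mul_sum,
      ← Finset.mul_sum, hNsum, ← hDsum]
  rw [hexpand] at hT
  have hre : -(|t| * ‖zT‖) ≤ -t * zT.re := by
    have h2 : |(-t) * zT.re| ≤ |t| * ‖zT‖ := by
      rw [abs_mul, abs_neg]
      exact mul_le_mul_of_nonneg_left (Complex.abs_re_le_norm zT) (abs_nonneg t)
    linarith [neg_abs_le ((-t) * zT.re)]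
  have h4 := mul_le_mul_of_nonneg_left hT (abs_nonneg t)
  rw [hform]
  nlinarith [h4, hre]

/-- **Attractive sector floor (pair-breaking counting).** Maximal degree `≤ Δ`, `ω ≥ 1`,
`-U ≤ |t|Δ(2ω - 2ω⁻¹)`: every nonempty joint sector has `minEnergyOn H (szSector N M) ≥ -|t|Δ ω N`.
With `ω = |U|/(2|t|Δ) + 2|t|Δ/|U|`: `E ≥ U N/2 - 2Δ²t² N/|U|`. -/
theorem pairBreaking_le_minEnergyOn_szSector {Δ : ℕ}
    (hΔ : ∀ v : Λ, (Finset.univ.filter (G.Adj v)).card ≤ Δ) {t U ω : ℝ} (hω : 1 ≤ ω)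
    (hU : -U ≤ |t| * Δ * (2 * ω - 2 * ω⁻¹)) (N : ℕ) (M : ℝ)
    (hK : ∃ ψ ∈ szSector (Λ := Λ) N M, star ψ ⬝ᵥ ψ = 1) :
    -(|t| * Δ * ω * N) ≤ (hamiltonian G t U).minEnergyOn (szSector N M) := by
  obtain ⟨ψ₀, hψ₀K, hψ₀⟩ := hK
  refine le_csInf ⟨_, ψ₀, hψ₀K, hψ₀, rfl⟩ ?_
  rintro E ⟨ψ, hψK, hψ1, rfl⟩
  have h := pairBreaking_le_re_expect_hamiltonian G hΔ t U hω ((mem_szSector_iff N M ψ).1 hψK).1 hψ1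
  have hD : 0 ≤ (star ψ ⬝ᵥ ((∑ x : Λ, numberOp x 0 * numberOp x 1) *ᵥ ψ)).re := by
    rw [re_expect_interaction_eq_sum]
    positivity
  have h5 := mul_nonneg (by linarith : 0 ≤ U + |t| * Δ * (2 * ω - 2 * ω⁻¹)) hD
  linarith

end Graph

/-! ### The torus: `E(U; N, M) ≥ -(|U|/2 + 32/|U|) N`, `E(U; 2m, 0) ≥ U m - 64 m/|U|` -/

variable {L : ℕ} [NeZero L]

/-- `1 ≤ a + a⁻¹` and `a ≤ (a + a⁻¹) - (a + a⁻¹)⁻¹` for `a > 0`. -/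
theorem one_le_add_inv_and_le_sub_inv {a : ℝ} (ha : 0 < a) :
    1 ≤ a + a⁻¹ ∧ a ≤ (a + a⁻¹) - (a + a⁻¹)⁻¹ := by
  have ha' : 0 < a⁻¹ := inv_pos.2 ha
  have haa : a * a⁻¹ = 1 := mul_inv_cancel₀ ha.ne'
  refine ⟨by nlinarith [sq_nonneg (a - 1)], ?_⟩
  have h : (a + a⁻¹)⁻¹ ≤ a⁻¹ := inv_anti₀ ha (by linarith)
  linarith

/-- **Pair-breaking floor on the torus (PROVED below).** `U < 0`, every `L`, every nonempty joint
sector `(N, S^z = M)` of `hubbardTorus 2 L 1 U` (`t = 1`, `Δ = 4`):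
`minEnergyOn H_U (szSector N M) ≥ -(|U|/2 + 32/|U|) N`. kind: support (PROVED). Why it might
fail: it cannot; the `t²/|U|` constant is loose by `≈ 4` (second-order perturbation theory).
Sources: Nagaoka1966 §II (mirrored); HazraVermaRanderia2019 App. G; bounds.tex Thm 9(i). -/
@[conjecture] def AttractivePairBreakingFloor : Prop :=
  ∀ (L : ℕ) [NeZero L] (U : ℝ) (N : ℕ) (M : ℝ), U < 0 →
    (∃ ψ ∈ szSector (Λ := FermionTorus 2 L) N M, star ψ ⬝ᵥ ψ = 1) →
      -((-U / 2 + 32 / (-U)) * N) ≤ (hubbardTorus 2 L 1 U).minEnergyOn (szSector N M)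

/-- **Proof of `AttractivePairBreakingFloor`**: `pairBreaking_le_minEnergyOn_szSector` on the torus
graph (`Δ = 4`) with `ω = |U|/8 + 8/|U|`. -/
theorem attractivePairBreakingFloor_holds : AttractivePairBreakingFloor := by
  intro L _ U N M hU hK
  have hΔ : ∀ v : FermionTorus 2 L,
      (Finset.univ.filter ((fermionTorusGraph 2 L).Adj v)).card ≤ 4 := fun v =>
    card_filter_fermionTorusGraph_adj_le v
  have ha : 0 < -U / 8 := by linarith
  obtain ⟨hω, hωa⟩ := one_le_add_inv_and_le_sub_inv ha
  set ω : ℝ := -U / 8 + (-U / 8)⁻¹ with hωdef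
  have hU' : -U ≤ |(1 : ℝ)| * (4 : ℕ) * (2 * ω - 2 * ω⁻¹) := by
    rw [abs_one, one_mul]; push_cast; linarith
  have h := pairBreaking_le_minEnergyOn_szSector (fermionTorusGraph 2 L) hΔ hω hU' N M hK
  rw [hubbardTorus]
  rw [abs_one, one_mul] at h
  push_cast at h
  have hωval : (4 : ℝ) * ω * N = (-U / 2 + 32 / (-U)) * N := by
    rw [hωdef, inv_div]
    ring
  linarith

/-- **Lower bracket `E_L(U; 2m, 0) ≥ U m - 64 m/|U|`** for `U < 0`, every `L`, `m ≤ L²`. -/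
theorem sectorEnergy_two_mul_ge_pairBreaking {U : ℝ} (hU : U < 0) {m : ℕ} (hm : m ≤ L ^ 2) :
    U * m - 64 * m / (-U) ≤ sectorEnergy L U (2 * m) 0 := by
  obtain ⟨ψ, h1, hgs⟩ := NoGo.exists_unit_groundStateInSector_hubbardTorus L 1 U hm
  have h := attractivePairBreakingFloor_holds L U (2 * m) 0 hU ⟨ψ, hgs.1, h1⟩
  rw [sectorEnergy]
  have hkey : -((-U / 2 + 32 / (-U)) * ((2 * m : ℕ) : ℝ)) = U * m - 64 * m / (-U) := by
    push_cast
    ring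
  linarith

end Summit.HubbardSuperconductivity.HubbardLadder.Bounds

end
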